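import Literature.Probability.NegativeDependence.NegativeAssociationEvents
import Literature.Probability.NegativeDependence.CNAImpliesHNLC
import Literature.Probability.NegativeDependence.ExchangeableCNAPlus
import Literature.Probability.NegativeDependence.AlmostExchangeableHNLC
import HarnessLib

/-!
# Almost exchangeable measures are CNA / CNA+ (Borcea–Brändén–Liggett, Theorem 6.4, Corollaries 6.5, 6.6)

J. Borcea, P. Brändén, T. M. Liggett, *Negative dependence and the geometry of polynomials*, J. Amer. Math. Soc.
22 (2009) 521–567 (arXiv:0707.2340, held `paper:arxiv-0707.2340`), §6. Verbatim:

> **Theorem 6.4.** Let `μ ∈ 𝔓_{n+1}` be such that its generating polynomial `g = g_μ` is symmetric in its first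
> `n` variables, so that `g(z_1,…,z_n) = z_{n+1} Σ_{k=0}^n a_k e_k(z_1,…,z_n) + Σ_{k=0}^n b_k e_k(z_1,…,z_n)`.
> Suppose that `{a_k}_{k=0}^n` and `{b_k}_{k=0}^n` are LC sequences that satisfy (i) `{a_k + b_k}_{k=0}^n` is LC,
> and (ii) `a_k b_{k+1} ≥ a_{k+1} b_k` for all `0 ≤ k ≤ n-1`. Then `μ` is CNA.
> *Proof.* […] First, observe that it is enough to prove that `μ` is NA […] if `μ` is conditioned on `X_i = 1`
> for `k` values of `i ≤ n`, on `X_i = 0` for `l` values of `i ≤ n`, and possibly on the value of `X_{n+1}`, the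
> resulting measure is of the same form […]. Now take two increasing functions `F` and `G` on `2^{[n+1]}` that
> depend on disjoint sets of coordinates […] `F` depends on the coordinates `{X_1,…,X_m}`, and `G` depends on
> the coordinates `{X_{m+1},…,X_{n+1}}`. We need to prove (cna1) `∫FG dμ ≤ ∫F dμ ∫G dμ`. Since `μ` is symmetric
> in the first `n` coordinates, these three integrals are not changed if `F` and `G` are replaced by the
> functions obtained by symmetrizing them […] `F(X_1,…,X_m) = f_k` if `Σ_{i=1}^m X_i = k`,
> `G(X_{m+1},…,X_n, X_{n+1} = 0) = g_k` […] and `G(X_{m+1},…,X_n, X_{n+1} = 1) = h_k` […], where `f_k, g_k` and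
> `h_k` are increasing, and `g_k ≤ h_k` for each `k`. Using the fact that the covariance of `F` and `G` […] can
> be written as `½ Σ_{S,T} [F(S) - F(T)][G(S) - G(T)] μ(S) μ(T)`, (cna1) becomes [(cna2):
> `Σ_{i<j} Σ_{k,ℓ} C(m,i)C(m,j)C(n-m,k)C(n-m,ℓ) (f_j - f_i)[(h_k - h_ℓ) a_{k+i} a_{ℓ+j} + (g_k - g_ℓ) b_{k+i} b_{ℓ+j}
> + (h_k - g_ℓ) a_{k+i} b_{ℓ+j} + (g_k - h_ℓ) a_{ℓ+j} b_{k+i}] ≥ 0`] […] Furthermore, it is enough to prove this in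
> case when the `g_k`'s and `h_k`'s take only the values `0` and `1`, since any increasing function on a partially
> ordered set (in this case, `{0,…,n} × {0,1}`) can be written as a positive linear combination of increasing
> functions that take only the values `0` and `1`. [cases (a) `h_ℓ = g_k = 1`: "non-negative by the log-concavity
> of the `b`'s and (ii): `a_{k+i}/a_{k+j} ≥ b_{k+i}/b_{k+j} ≥ b_{ℓ+i}/b_{ℓ+j}`"; (b) `h_ℓ = 0, g_k = 1`:
> "non-negative by (i)"; (c) `h_ℓ = g_k = 0`: "by the log-concavity of the `a`'s and (ii)"; (d) `h_ℓ = 1,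
> g_k = 0`: summation by parts.] □
> **Corollary 6.5.** Suppose `{a_k}_{k=0}^n` and `{b_k}_{k=0}^n` are LC sequences that satisfy (i) `{λ a_k + b_k}`
> is LC for all `λ > 0`, and (ii) `a_k b_{k+1} ≥ a_{k+1} b_k` for `0 ≤ k < n`. Then `μ` is CNA+. *Proof.* [the
> weighted symmetrization `f_k = c_k^{-1} Σ F(S) Π w_i^{X_i(S)}`; "the effect of `w_{n+1}` is to replace `a_k` by a
> constant multiple of `a_k`"; "(a) `f_k ≤ f_{k+1}`, `g_k ≤ g_{k+1}`, `h_k ≤ h_{k+1}` and `g_k ≤ h_k` […] and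
> (b) `{d_k}` is an LC sequence", "`d_k` is just the `k`-th elementary symmetric function on `{w_{m+1},…,w_n}`".] □
> **Corollary 6.6.** If `μ` is an almost symmetric measure (i.e., its generating polynomial is symmetric in all
> but possibly one variable), then • `μ` is Rayleigh/h-NLC+ ⟺ `μ` is CNA+; • `μ` is h-NLC ⟺ `μ` is CNA.
> [By Remark 2.4, Prop. 6.2 + Cor. 6.5, Prop. 6.3 + Thm. 6.4.]

## Transposition and road

As in `AlmostExchangeableRayleigh.lean` / `AlmostExchangeableHNLC.lean`: the variables are indexed by `Option τ`
(`|τ| = n`, `z_{n+1}` = `none`), the weight is `almostExch a b`, LC = `IsLogConcaveSeq` (BBL Def. 2.8: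
nonnegative, log-concave, no internal zeros), NA / CNA / CNA+ = `IsNegAssoc` / `IsCNA` / `IsCNAPlus`
(`NegativeAssociationHierarchy.lean`, unnormalized: `∫FG dμ · μ(Ω) ≤ ∫F dμ ∫G dμ`).

The proof follows the print up to (cna2) — conditioning keeps the form (`∗` conditioned out / in gives an
exchangeable weight with profile `b` / `a`, the tree's `isNegAssoc_pin_extField_card`; `∗` free is the main
case), weighted symmetrization with the tree's `wAvg_mono` (Cor. 6.5 (a), from Thm. 4.19) and
`isLogConcaveSeq_esymmVal` (Cor. 6.5 (b)), and the reduction of (cna2) to the pairs `i < j`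
(`sum_mul_sum_le_of_ratio`); then the 0/1 reduction on `{0,…,M} × {0,1}` (the tree's finite layer cake
`sum_mul_nonneg_of_upperSets`, on `Fin (M+1) × Bool` with the product order). For 0/1-valued `g ≤ h`
(`h = 𝟏_{k ≥ s}`, `g = 𝟏_{k ≥ t}`, `s ≤ t`) the pair inequality is organised by the THREE ZONES `k < s`,
`s ≤ k < t`, `k ≥ t` instead of the printed windows `|k - ℓ| ≤ 2q`: the blocks of cases (a), (b), (c) are
termwise nonnegative exactly as printed (`cross_le` is the displayed chain of ratios, with Lemma 6.1's zero
bookkeeping), and the case-(d) block — the only one whose terms "need not be non-negative" — is the `2 × 2` minor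
`(Σ a_{j+k} w_k)(Σ b_{i+k} w_k) ≤ (Σ a_{i+k} w_k)(Σ b_{j+k} w_k)` of `C · W` (`C = (a ; b)` `TP₂` by Lemma 6.1 and
(ii), `W` the Toeplitz matrix of the `PF₂` window `d · 𝟏_{[s,t)}`), settled by the Cauchy–Binet step of the
proof of Prop. 6.2 (the tree's `cauchyBinet_two_nonneg`, `tp2_of_lc`) in place of the printed summation by
parts. Projections in Cor. 6.5 come from `IsCNA.projectOn` (CNA passes to projections), so no projected profiles
are needed; Cor. 6.6 uses Props. 6.2/6.3 (tree) and Remark 2.4 (`IsCNAPlus.isRayleigh`, `IsCNA.isHNLC`).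

## Contents

* §1 `cross_le`, `sum_mul_sum_le_of_ratio`, `zoneSum_mul_le`, `window_tp2` (case (d) by Cauchy–Binet),
  **`threshold_le`** (cases (a)–(d) for 0/1-valued `g ≤ h`).
* §2 `sum_finBool`, `mem_upperSet_row_iff`, **`upset_ratio_le`** (the 0/1 reduction).
* §3 `ex_pin_eq_sum_powerset`, `sum_powerset_insert`, `sum_powerset_powerset_regroup`,
  `pin_extField_almostExch_of_mem_O/_of_mem_I`, `isLogConcaveSeq_succShift`, **`negAssoc_almostExch_aux`**,
  **`isNegAssoc_pin_extField_almostExch`**.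
* §4 **`isCNA_almostExch`** (Thm. 6.4), `isNegAssoc_almostExch`, **`isCNAPlus_almostExch`** (Cor. 6.5),
  **`BorceaBrandenLiggett_cor_6_6_rayleigh`**, **`BorceaBrandenLiggett_cor_6_6_hnlc`**,
  **`BorceaBrandenLiggett_cor_6_6`** (Cor. 6.6).

## References

* [BorceaBrandenLiggett2007] J. Borcea, P. Brändén, T. M. Liggett, Negative dependence and the geometry of
  polynomials, J. Amer. Math. Soc. 22 (2009); arXiv:0707.2340 — §6 Thm. 6.4, Cor. 6.5, Cor. 6.6 and their
  proofs; Lemma 6.1, Props. 6.2, 6.3; §2.1 Def. 2.7, Remark 2.4; §4.3.2 Thm. 4.19.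
* [Pemantle2000] R. Pemantle, Towards a theory of negative dependence, J. Math. Phys. 41 (2000) — §2.2
  (CNA, CNA+), Conjecture 2 / BBL's "Pemantle's Conjecture 2.5".
* [Karlin1968] S. Karlin, Total positivity — Ch. 8 §1 (`PF₂`, `TP₂`, Cauchy–Binet).
-/

noncomputable section

open Finset
open Literature.Combinatorics.Sahi2008
open Literature.Combinatorics.StablePolynomials
open Literature.Probability.Distributions

universe u

namespace Literature.Probability.NegativeDependence

/-! ## §1 Sequence inequalities: the cross lemma, the three zones, the (d)-block by Cauchy–Binet -/

section Sequences

/-- **The cross inequality** behind cases (a) and (c) of the printed proof: for `a ≥ 0`, `b` LC and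
`C = (a ; b)` `TP₂`, `a_v b_{u'} ≤ a_u b_{v'}` whenever `u' ≤ u ≤ v` and `u + v' = u' + v` ("by the
log-concavity of the `b`'s and (ii): `a_{k+i}/a_{k+j} ≥ b_{k+i}/b_{k+j} ≥ b_{ℓ+i}/b_{ℓ+j}`", with the zero cases
handled by Lemma 6.1's mechanism). [cite: BorceaBrandenLiggett2007, §6 proof of Thm. 6.4, cases (a), (c);
Lemma 6.1] -/
theorem cross_le {a b : ℕ → ℝ} (ha : ∀ k, 0 ≤ a k) (hb : IsLogConcaveSeq b)
    (hC : ∀ i j, i < j → a j * b i ≤ a i * b j) {u' u v v' : ℕ} (h1 : u' ≤ u) (h2 : u ≤ v)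
    (h3 : u + v' = u' + v) : a v * b u' ≤ a u * b v' := by
  rcases (ha v).eq_or_lt with hav | hav
  · rw [← hav, zero_mul]; exact mul_nonneg (ha u) (hb.1 v')
  rcases (hb.1 u').eq_or_lt with hbu | hbu
  · rw [← hbu, mul_zero]; exact mul_nonneg (ha u) (hb.1 v')
  rcases (h1.trans h2).lt_or_eq with huv | huv
  swap
  · have hu : u = v := le_antisymm h2 (huv ▸ h1)
    have hv' : v' = u' := by omega
    rw [hu, hv', huv]
  have hbv : 0 < b v := by
    by_contra hle
    have hbv0 : b v = 0 := le_antisymm (not_lt.1 hle) (hb.1 v)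
    have h := hC u' v huv
    rw [hbv0, mul_zero] at h
    exact absurd (lt_of_lt_of_le (mul_pos hav hbu) h) (lt_irrefl 0)
  have hbu' : 0 < b u := hb.pos_of_mem_Icc hbu hbv h1 h2
  have hC' : a v * b u ≤ a u * b v := by
    rcases h2.lt_or_eq with hlt | heq
    · exact hC u v hlt
    · rw [heq]
  have hLC : b u' * b v ≤ b u * b v' := hb.mul_le_mul h1 h2 (by omega)
  have key : a v * b u' * (b u * b v) ≤ a u * b v' * (b u * b v) :=
    calc a v * b u' * (b u * b v) = (a v * b u) * (b u' * b v) := by ring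
      _ ≤ (a u * b v) * (b u * b v') :=
          mul_le_mul hC' hLC (mul_nonneg (hb.1 _) (hb.1 _)) (mul_nonneg (ha _) (hb.1 _))
      _ = a u * b v' * (b u * b v) := by ring
  exact le_of_mul_le_mul_right key (mul_pos hbu' hbv)

/-- **Chebyshev's sum inequality in `TP₂` form** (the reduction of (cna1) to the pairs `i < j` with the weight
`f_j - f_i ≥ 0`): if `A_j Z_i ≤ A_i Z_j` for `i < j` and `f` is increasing then
`(Σ f_i A_i)(Σ Z_i) ≤ (Σ f_i Z_i)(Σ A_i)`. [cite: BorceaBrandenLiggett2007, §6 proof of Thm. 6.4 ((cna1) ⟹ (cna2):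
"this can be written as `Σ_{i<j} … (f_j - f_i)[…] ≥ 0`")] -/
theorem sum_mul_sum_le_of_ratio (M : ℕ) (f A Z : ℕ → ℝ)
    (hAZ : ∀ i j, i < j → j ≤ M → A j * Z i ≤ A i * Z j) (hf : ∀ i j, i ≤ j → j ≤ M → f i ≤ f j) :
    (∑ i ∈ range (M + 1), f i * A i) * (∑ i ∈ range (M + 1), Z i) ≤
      (∑ i ∈ range (M + 1), f i * Z i) * (∑ i ∈ range (M + 1), A i) := by
  have ht : ∀ i ∈ range (M + 1), ∀ j ∈ range (M + 1), 0 ≤ (f j - f i) * (A i * Z j - A j * Z i) := by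
    intro i hi j hj
    rw [Finset.mem_range] at hi hj
    rcases lt_trichotomy i j with h | rfl | h
    · exact mul_nonneg (sub_nonneg.2 (hf i j h.le (by omega))) (sub_nonneg.2 (hAZ i j h (by omega)))
    · simp
    · exact mul_nonneg_of_nonpos_of_nonpos (sub_nonpos.2 (hf j i h.le (by omega)))
        (sub_nonpos.2 (hAZ j i h (by omega)))
  have hsum : ∑ i ∈ range (M + 1), ∑ j ∈ range (M + 1), (f j - f i) * (A i * Z j - A j * Z i) =
      2 * ((∑ i ∈ range (M + 1), f i * Z i) * (∑ i ∈ range (M + 1), A i) -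
        (∑ i ∈ range (M + 1), f i * A i) * (∑ i ∈ range (M + 1), Z i)) := by
    have e : ∀ i j, (f j - f i) * (A i * Z j - A j * Z i) =
        (A i * (f j * Z j) + (f i * Z i) * A j) - (Z i * (f j * A j) + (f i * A i) * Z j) := fun i j => by ring
    simp only [e, Finset.sum_sub_distrib, Finset.sum_add_distrib, ← Finset.sum_mul_sum]
    ring
  have hnn : 0 ≤ ∑ i ∈ range (M + 1), ∑ j ∈ range (M + 1), (f j - f i) * (A i * Z j - A j * Z i) :=
    Finset.sum_nonneg fun i hi => Finset.sum_nonneg fun j hj => ht i hi j hj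
  rw [hsum] at hnn
  linarith

/-- Termwise comparison of a product of two zone sums. [cite: BorceaBrandenLiggett2007, §6 proof of Thm. 6.4
(cases (a)–(c): "(cna3) is non-negative")] -/
theorem zoneSum_mul_le (RM : Finset ℕ) (P Q : ℕ → Prop) [DecidablePred P] [DecidablePred Q]
    (φ ψ φ' ψ' : ℕ → ℝ) (h : ∀ k k', P k → Q k' → φ k * ψ k' ≤ φ' k * ψ' k') :
    (∑ k ∈ RM, if P k then φ k else 0) * (∑ k' ∈ RM, if Q k' then ψ k' else 0) ≤
      (∑ k ∈ RM, if P k then φ' k else 0) * (∑ k' ∈ RM, if Q k' then ψ' k' else 0) := by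
  rw [Finset.sum_mul_sum, Finset.sum_mul_sum]
  refine Finset.sum_le_sum fun k _ => Finset.sum_le_sum fun k' _ => ?_
  split_ifs with hP hQ
  · exact h k k' hP hQ
  all_goals simp

/-- **The (d)-block**: `(Σ_{s≤k<t} D_k a_{j+k})(Σ_{s≤k<t} D_k b_{i+k}) ≤ (Σ_{s≤k<t} D_k a_{i+k})(Σ_{s≤k<t} D_k b_{j+k})`
for `i < j` — the `2 × 2` minor of `C · W`, `C = (a ; b)` `TP₂` (Lemma 6.1 and (ii), the tree's `tp2_of_lc`) and
`W` the Toeplitz matrix of the `PF₂` window `D · 𝟏_{[s,t)}`, by the Cauchy–Binet step of the proof of Prop. 6.2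
(used here in place of the printed summation by parts for case (d)). [cite: BorceaBrandenLiggett2007, §6 proof
of Prop. 6.2 ("by the Cauchy–Binet formula so is `CE`"); proof of Thm. 6.4, case (d)] -/
theorem window_tp2 {a b D : ℕ → ℝ} (ha : ∀ k, 0 ≤ a k) (hb : ∀ k, 0 ≤ b k)
    (hab : IsLogConcaveSeq fun k => a k + b k) (hii : ∀ k, a (k + 1) * b k ≤ a k * b (k + 1))
    (hD : IsLogConcaveSeq D) (M s t : ℕ) {i j : ℕ} (hij : i < j) :
    (∑ k ∈ range (M + 1), if s ≤ k ∧ k < t then D k * a (j + k) else 0) *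
        (∑ k ∈ range (M + 1), if s ≤ k ∧ k < t then D k * b (i + k) else 0) ≤
      (∑ k ∈ range (M + 1), if s ≤ k ∧ k < t then D k * a (i + k) else 0) *
        (∑ k ∈ range (M + 1), if s ≤ k ∧ k < t then D k * b (j + k) else 0) := by
  set w : ℕ → ℝ := fun n => if n ≤ M then (if n < t then (if s ≤ n then D n else 0) else 0) else 0 with hw
  have hwLC : IsLogConcaveSeq w := ((hD.truncGE s).truncLT t).truncLE M
  have hw_of_le : ∀ k, k ≤ M → w k = if s ≤ k ∧ k < t then D k else 0 := fun k hk => by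
    simp only [hw, if_pos hk]
    by_cases h1 : k < t
    · by_cases h2 : s ≤ k
      · rw [if_pos h1, if_pos h2, if_pos ⟨h2, h1⟩]
      · rw [if_pos h1, if_neg h2, if_neg (fun h => h2 h.1)]
    · rw [if_neg h1, if_neg (fun h => h1 h.2)]
  have hw_of_gt : ∀ k, M < k → w k = 0 := fun k hk => by simp only [hw, if_neg (not_le.2 hk)]
  set N := j + (M + 1) with hN
  have reindex : ∀ (g : ℕ → ℝ) (x : ℕ), x ≤ j →
      ∑ n ∈ range N, g n * (if x ≤ n then w (n - x) else 0) =
        ∑ k ∈ range (M + 1), if s ≤ k ∧ k < t then D k * g (x + k) else 0 := by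
    intro g x hx
    have hxN : x ≤ N := by omega
    have h1 : ∑ n ∈ range x, g n * (if x ≤ n then w (n - x) else 0) = 0 :=
      Finset.sum_eq_zero fun n hn => by
        rw [Finset.mem_range] at hn
        rw [if_neg (by omega), mul_zero]
    have h2 : ∑ k ∈ Finset.Ico (M + 1) (N - x), g (x + k) * (if x ≤ x + k then w (x + k - x) else 0) = 0 :=
      Finset.sum_eq_zero fun k hk => by
        rw [Finset.mem_Ico] at hk
        rw [if_pos (Nat.le_add_right x k), Nat.add_sub_cancel_left, hw_of_gt k (by omega), mul_zero]
    rw [← Finset.sum_range_add_sum_Ico _ hxN, h1, zero_add, Finset.sum_Ico_eq_sum_range,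
      ← Finset.sum_range_add_sum_Ico _ (show M + 1 ≤ N - x by omega), h2, add_zero]
    refine Finset.sum_congr rfl fun k hk => ?_
    rw [Finset.mem_range] at hk
    rw [if_pos (Nat.le_add_right x k), Nat.add_sub_cancel_left, hw_of_le k (by omega)]
    split_ifs <;> ring
  set u : ℕ → ℝ := fun n => if i ≤ n then w (n - i) else 0 with hu
  set v : ℕ → ℝ := fun n => if j ≤ n then w (n - j) else 0 with hv
  have hE : ∀ k l, k < l → u l * v k ≤ u k * v l := by
    intro k l hkl
    simp only [hu, hv]
    by_cases hjk : j ≤ k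
    · rw [if_pos (by omega : i ≤ l), if_pos hjk, if_pos (by omega : i ≤ k), if_pos (by omega : j ≤ l)]
      have key := hwLC.mul_le_mul (a := k - j) (b := k - i) (c := l - j) (d := l - i) (by omega) (by omega)
        (by omega)
      linarith [mul_comm (w (l - i)) (w (k - j)), mul_comm (w (k - i)) (w (l - j))]
    · rw [if_neg hjk, mul_zero]
      exact mul_nonneg (by split_ifs; exacts [hwLC.1 _, le_rfl]) (by split_ifs; exacts [hwLC.1 _, le_rfl])
  have key := cauchyBinet_two_nonneg N (a := a) (b := b) (u := u) (v := v)
    (fun k l hkl => tp2_of_lc ha hb hab hii hkl) hE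
  simp only [hu, hv] at key
  rw [reindex a j le_rfl, reindex b i hij.le, reindex a i hij.le, reindex b j le_rfl] at key
  exact key

/-- **The threshold inequality** (BBL's `S_q ≥ 0` for 0/1-valued `g ≤ h`, i.e. `h = 𝟏_{k ≥ s}`, `g = 𝟏_{k ≥ t}`,
`s ≤ t`): with `A_x = Σ_k D_k ([t ≤ k] b_{x+k} + [s ≤ k] a_{x+k})` (mass of the up-set at level `x`) and
`Z_x = Σ_k D_k (b_{x+k} + a_{x+k})`, one has `A_j Z_i ≤ A_i Z_j` for `i < j`. Proof: three zones `k < s`,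
`s ≤ k < t`, `k ≥ t`; the blocks `R·L` (case (b): log-concavity of `a + b`), `R·M_b` (case (a)), `M_a·L`
(case (c)) are termwise nonnegative as printed, and the `M_a·M_b` block (case (d)) is `window_tp2`.
[cite: BorceaBrandenLiggett2007, §6 proof of Thm. 6.4 (cases (a)–(d))] -/
theorem threshold_le {a b D : ℕ → ℝ} (ha : IsLogConcaveSeq a) (hb : IsLogConcaveSeq b)
    (hab : IsLogConcaveSeq fun k => a k + b k) (hii : ∀ k, a (k + 1) * b k ≤ a k * b (k + 1))
    (hD : IsLogConcaveSeq D) (M : ℕ) {s t : ℕ} (hst : s ≤ t) {i j : ℕ} (hij : i < j) :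
    (∑ k ∈ range (M + 1), D k * ((if t ≤ k then b (j + k) else 0) + if s ≤ k then a (j + k) else 0)) *
        (∑ k ∈ range (M + 1), D k * (b (i + k) + a (i + k))) ≤
      (∑ k ∈ range (M + 1), D k * ((if t ≤ k then b (i + k) else 0) + if s ≤ k then a (i + k) else 0)) *
        (∑ k ∈ range (M + 1), D k * (b (j + k) + a (j + k))) := by
  set RM := range (M + 1) with hRM
  set c : ℕ → ℝ := fun k => a k + b k with hc
  have hcLC : IsLogConcaveSeq c := hab
  have hC : ∀ i j, i < j → a j * b i ≤ a i * b j := fun i j h => tp2_of_lc ha.1 hb.1 hab hii h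
  -- the zone pieces at level `x`
  set R : ℕ → ℝ := fun x => ∑ k ∈ RM, if t ≤ k then D k * c (x + k) else 0 with hR
  set L : ℕ → ℝ := fun x => ∑ k ∈ RM, if k < s then D k * c (x + k) else 0 with hL
  set Ma : ℕ → ℝ := fun x => ∑ k ∈ RM, if s ≤ k ∧ k < t then D k * a (x + k) else 0 with hMa
  set Mb : ℕ → ℝ := fun x => ∑ k ∈ RM, if s ≤ k ∧ k < t then D k * b (x + k) else 0 with hMb
  have hA : ∀ x, ∑ k ∈ RM, D k * ((if t ≤ k then b (x + k) else 0) + if s ≤ k then a (x + k) else 0) =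
      R x + Ma x := by
    intro x
    simp only [hR, hMa]
    rw [← Finset.sum_add_distrib]
    refine Finset.sum_congr rfl fun k _ => ?_
    split_ifs <;> (try simp only [hc]) <;> first | (exfalso; omega) | ring
  have hZ : ∀ x, ∑ k ∈ RM, D k * (b (x + k) + a (x + k)) = (R x + Ma x) + (L x + Mb x) := by
    intro x
    simp only [hR, hMa, hL, hMb]
    rw [← Finset.sum_add_distrib, ← Finset.sum_add_distrib, ← Finset.sum_add_distrib]
    refine Finset.sum_congr rfl fun k _ => ?_
    split_ifs <;> (try simp only [hc]) <;> first | (exfalso; omega) | ring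
  rw [hA j, hA i, hZ i, hZ j]
  -- the four blocks
  have scale : ∀ (k k' : ℕ) (p q p' q' : ℝ), p * q ≤ p' * q' →
      D k * p * (D k' * q) ≤ D k * p' * (D k' * q') := fun k k' p q p' q' h =>
    calc D k * p * (D k' * q) = (D k * D k') * (p * q) := by ring
      _ ≤ (D k * D k') * (p' * q') := mul_le_mul_of_nonneg_left h (mul_nonneg (hD.1 k) (hD.1 k'))
      _ = D k * p' * (D k' * q') := by ring
  have T1 : R j * L i ≤ R i * L j := by
    refine zoneSum_mul_le RM _ _ _ _ _ _ fun k k' hk hk' => scale k k' _ _ _ _ ?_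
    have := hcLC.mul_le_mul (a := i + k') (b := i + k) (c := j + k') (d := j + k) (by omega) (by omega) (by omega)
    linarith [mul_comm (c (j + k)) (c (i + k'))]
  have T2 : R j * Mb i ≤ R i * Mb j := by
    refine zoneSum_mul_le RM _ _ _ _ _ _ fun k k' hk hk' => scale k k' _ _ _ _ ?_
    have hbb := hb.mul_le_mul (a := i + k') (b := i + k) (c := j + k') (d := j + k) (by omega) (by omega) (by omega)
    have hab' := cross_le ha.1 hb hC (u' := i + k') (u := i + k) (v := j + k) (v' := j + k') (by omega) (by omega)
      (by omega)
    simp only [hc]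
    nlinarith [hbb, hab']
  have T3 : Ma j * L i ≤ Ma i * L j := by
    refine zoneSum_mul_le RM _ _ _ _ _ _ fun k k' hk hk' => scale k k' _ _ _ _ ?_
    have haa := ha.mul_le_mul (a := i + k') (b := i + k) (c := j + k') (d := j + k) (by omega) (by omega) (by omega)
    have hab' := cross_le ha.1 hb hC (u' := i + k') (u := i + k) (v := j + k) (v' := j + k') (by omega) (by omega)
      (by omega)
    simp only [hc]
    nlinarith [haa, hab']
  have T4 : Ma j * Mb i ≤ Ma i * Mb j := window_tp2 ha.1 hb.1 hab hii hD M s t hij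
  have hAB : (R j + Ma j) * (L i + Mb i) ≤ (R i + Ma i) * (L j + Mb j) := by nlinarith [T1, T2, T3, T4]
  nlinarith [hAB]

end Sequences

/-! ## §2 The 0/1 reduction on `{0,…,M} × {0,1}` -/

section LayerCake

/-- Sums over `Fin (M+1) × Bool` as range sums. [cite: BorceaBrandenLiggett2007, §6 proof of Thm. 6.4 (the
poset `{0,…,n} × {0,1}`)] -/
theorem sum_finBool (M : ℕ) (F : ℕ → Bool → ℝ) :
    ∑ y : Fin (M + 1) × Bool, F y.1 y.2 = ∑ k ∈ range (M + 1), (F k true + F k false) := by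
  rw [Fintype.sum_prod_type]
  simp only [Fintype.sum_bool]
  exact Fin.sum_univ_eq_sum_range (fun k => F k true + F k false) (M + 1)

/-- An up-set of the chain `Fin (M+1)` (inside a row of `Fin (M+1) × Bool`) is a final segment: membership is
`t ≤ k` with `t` the number of non-members. [cite: BorceaBrandenLiggett2007, §6 proof of Thm. 6.4 ("increasing
functions that take only the values 0 and 1")] -/
theorem mem_upperSet_row_iff {M : ℕ} {U : Finset (Fin (M + 1) × Bool)} (hU : IsUpperSet (U : Set (Fin (M + 1) × Bool)))
    (c : Bool) (k : Fin (M + 1)) :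
    (k, c) ∈ U ↔ (Finset.univ.filter fun k' : Fin (M + 1) => (k', c) ∉ U).card ≤ (k : ℕ) := by
  set Dn := Finset.univ.filter fun k' : Fin (M + 1) => (k', c) ∉ U with hDn
  constructor
  · intro hk
    have hsub : Dn ⊆ Finset.Iio k := fun k' hk' => by
      rw [Finset.mem_Iio]
      by_contra hle
      have hkk' : (k, c) ≤ (k', c) := Prod.mk_le_mk.2 ⟨not_lt.1 hle, le_rfl⟩
      exact (Finset.mem_filter.1 hk').2 (hU hkk' hk)
    have := Finset.card_le_card hsub
    rwa [Fin.card_Iio] at this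
  · intro hcard
    by_contra hk
    have hsub : Finset.Iic k ⊆ Dn := fun k' hk' => by
      rw [Finset.mem_Iic] at hk'
      refine Finset.mem_filter.2 ⟨Finset.mem_univ _, fun hk'U => hk ?_⟩
      exact hU (Prod.mk_le_mk.2 ⟨hk', le_rfl⟩) hk'U
    have := Finset.card_le_card hsub
    rw [Fin.card_Iic] at this
    omega

/-- **Stochastic monotonicity of the up-set masses** (the content of BBL's (cna2) ≥ 0 at a fixed pair `i < j`):
for `g ≤ h` increasing on `[0, M]` (an increasing function on `{0,…,M} × {0,1}`),
`A_j(g,h) Z_i ≤ A_i(g,h) Z_j` with `A_x(g,h) = Σ_k D_k (b_{x+k} g_k + a_{x+k} h_k)`, `Z_x = A_x(1,1)` — by the 0/1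
reduction ("any increasing function on a partially ordered set […] can be written as a positive linear combination
of increasing functions that take only the values 0 and 1") and `threshold_le`. [cite: BorceaBrandenLiggett2007,
§6 proof of Thm. 6.4] -/
theorem upset_ratio_le {a b D : ℕ → ℝ} (ha : IsLogConcaveSeq a) (hb : IsLogConcaveSeq b)
    (hab : IsLogConcaveSeq fun k => a k + b k) (hii : ∀ k, a (k + 1) * b k ≤ a k * b (k + 1))
    (hD : IsLogConcaveSeq D) (M : ℕ) {g h : ℕ → ℝ} (hg : ∀ k k', k ≤ k' → k' ≤ M → g k ≤ g k')
    (hh : ∀ k k', k ≤ k' → k' ≤ M → h k ≤ h k') (hgh : ∀ k, k ≤ M → g k ≤ h k) {i j : ℕ} (hij : i < j) :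
    (∑ k ∈ range (M + 1), D k * (b (j + k) * g k + a (j + k) * h k)) *
        (∑ k ∈ range (M + 1), D k * (b (i + k) + a (i + k))) ≤
      (∑ k ∈ range (M + 1), D k * (b (i + k) * g k + a (i + k) * h k)) *
        (∑ k ∈ range (M + 1), D k * (b (j + k) + a (j + k))) := by
  set Z : ℕ → ℝ := fun x => ∑ k ∈ range (M + 1), D k * (b (x + k) + a (x + k)) with hZ
  set K : ℕ → Bool → ℝ := fun n c =>
    bif c then D n * a (i + n) * Z j - D n * a (j + n) * Z i else D n * b (i + n) * Z j - D n * b (j + n) * Z i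
    with hK
  set Pf : ℕ → Bool → ℝ := fun n c => bif c then h n else g n with hPf
  set κ : Fin (M + 1) × Bool → ℝ := fun y => K y.1 y.2 with hκ
  set φ : Fin (M + 1) × Bool → ℝ := fun y => Pf y.1 y.2 with hφ
  have hφm : Monotone φ := by
    rintro ⟨k, c⟩ ⟨k', c'⟩ hle
    obtain ⟨hk, hc⟩ := Prod.mk_le_mk.1 hle
    have hk' : (k : ℕ) ≤ k' := hk
    have hkM : (k' : ℕ) ≤ M := Nat.lt_succ_iff.1 k'.isLt
    simp only [hφ, hPf]
    cases c <;> cases c'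
    · exact hg k k' hk' hkM
    · exact (hg k k' hk' hkM).trans (hgh k' hkM)
    · exact absurd hc (by decide)
    · exact hh k k' hk' hkM
  -- pairing
  have pair : ∑ y, φ y * κ y = Z j * (∑ k ∈ range (M + 1), D k * (b (i + k) * g k + a (i + k) * h k)) -
      Z i * (∑ k ∈ range (M + 1), D k * (b (j + k) * g k + a (j + k) * h k)) := by
    have hfb := sum_finBool M (fun n c => Pf n c * K n c)
    simp only [hφ, hκ]
    rw [hfb, Finset.mul_sum, Finset.mul_sum, ← Finset.sum_sub_distrib]
    refine Finset.sum_congr rfl fun k _ => ?_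
    simp only [hPf, hK, cond_true, cond_false]
    ring
  -- total mass zero
  have h0 : ∑ y, κ y = 0 := by
    simp only [hκ]
    rw [sum_finBool M K]
    have e : ∀ k, K k true + K k false = Z j * (D k * (b (i + k) + a (i + k))) - Z i * (D k * (b (j + k) + a (j + k))) :=
      fun k => by simp only [hK, cond_true, cond_false]; ring
    rw [Finset.sum_congr rfl fun k _ => e k, Finset.sum_sub_distrib, ← Finset.mul_sum, ← Finset.mul_sum]
    rw [show (∑ k ∈ range (M + 1), D k * (b (i + k) + a (i + k))) = Z i from rfl,
      show (∑ k ∈ range (M + 1), D k * (b (j + k) + a (j + k))) = Z j from rfl]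
    ring
  -- up-sets: thresholds
  have hU : ∀ U : Finset (Fin (M + 1) × Bool), IsUpperSet (U : Set (Fin (M + 1) × Bool)) → 0 ≤ ∑ y ∈ U, κ y := by
    intro U hUup
    set tT := (Finset.univ.filter fun k' : Fin (M + 1) => (k', true) ∉ U).card with htT
    set tF := (Finset.univ.filter fun k' : Fin (M + 1) => (k', false) ∉ U).card with htF
    have hTF : tT ≤ tF := by
      refine Finset.card_le_card fun k hk => ?_
      rw [Finset.mem_filter] at hk ⊢
      exact ⟨hk.1, fun hkF => hk.2 (hUup (Prod.mk_le_mk.2 ⟨le_rfl, Bool.false_le _⟩) hkF)⟩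
    have hsum : (∑ y : Fin (M + 1) × Bool, if y ∈ U then κ y else 0) = ∑ y ∈ U, κ y := by
      rw [Finset.sum_ite_mem, Finset.univ_inter]
    set G : ℕ → Bool → ℝ := fun n c =>
      bif c then (if tT ≤ n then K n true else 0) else (if tF ≤ n then K n false else 0) with hG
    have hpt : ∀ y : Fin (M + 1) × Bool, (if y ∈ U then κ y else 0) = G y.1 y.2 := by
      rintro ⟨k, c⟩
      cases c
      · simp only [hκ, hG, cond_false]
        exact if_congr (mem_upperSet_row_iff hUup false k) rfl rfl
      · simp only [hκ, hG, cond_true]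
        exact if_congr (mem_upperSet_row_iff hUup true k) rfl rfl
    -- the threshold sums
    have e : ∀ k, G k true + G k false =
        Z j * (D k * ((if tF ≤ k then b (i + k) else 0) + if tT ≤ k then a (i + k) else 0)) -
          Z i * (D k * ((if tF ≤ k then b (j + k) else 0) + if tT ≤ k then a (j + k) else 0)) := fun k => by
      simp only [hG, hK, cond_true, cond_false]
      split_ifs <;> ring
    rw [← hsum, Finset.sum_congr rfl fun y _ => hpt y, sum_finBool M G,
      Finset.sum_congr rfl fun k _ => e k, Finset.sum_sub_distrib, ← Finset.mul_sum, ← Finset.mul_sum]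
    have key := threshold_le ha hb hab hii hD M hTF hij
    rw [show (∑ k ∈ range (M + 1), D k * (b (i + k) + a (i + k))) = Z i from rfl,
      show (∑ k ∈ range (M + 1), D k * (b (j + k) + a (j + k))) = Z j from rfl] at key
    nlinarith [key]
  have key := sum_mul_nonneg_of_upperSets κ h0 hU hφm
  rw [pair] at key
  nlinarith [key]

end LayerCake

/-! ## §3 Symmetrization of the conditioned, reweighted almost exchangeable weight -/

section Symmetrization

variable {τ : Type u} [Fintype τ] [DecidableEq τ]

/-- Expectations under a conditioned weight, reindexed by the free part `T = S ∖ I ⊆ (I ∪ O)ᶜ`.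
[cite: BorceaBrandenLiggett2007, §6 proof of Thm. 6.4 (the conditioned measure "is of the same form");
§2.1 (conditioning)] -/
theorem ex_pin_eq_sum_powerset {σ : Type u} [Fintype σ] [DecidableEq σ] {μ : Finset σ → ℝ} {I O : Finset σ}
    (hIO : Disjoint I O) (H : Finset σ → ℝ) :
    ex (pin I O μ) H = ∑ T ∈ ((I ∪ O)ᶜ).powerset, μ (I ∪ T) * H (I ∪ T) := by
  rw [ex_def]
  have step : ∀ S : Finset σ, pin I O μ S * H S = if I ⊆ S ∧ Disjoint O S then μ S * H S else 0 := fun S => by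
    rw [pin_apply]; split_ifs <;> simp
  rw [Finset.sum_congr rfl fun S _ => step S, ← Finset.sum_filter]
  refine Finset.sum_bij' (fun S _ => S \ I) (fun T _ => I ∪ T) (fun S hS => ?_) (fun T hT => ?_)
    (fun S hS => ?_) (fun T hT => ?_) (fun S hS => ?_)
  · obtain ⟨-, hIS, hOS⟩ := Finset.mem_filter.1 hS
    rw [Finset.mem_powerset]
    intro x hx
    rw [Finset.mem_sdiff] at hx
    rw [Finset.mem_compl, Finset.mem_union, not_or]
    exact ⟨hx.2, fun hxO => Finset.disjoint_left.1 hOS hxO hx.1⟩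
  · rw [Finset.mem_powerset] at hT
    refine Finset.mem_filter.2 ⟨Finset.mem_univ _, Finset.subset_union_left, Finset.disjoint_left.2 fun x hxO hx => ?_⟩
    rcases Finset.mem_union.1 hx with hxI | hxT
    · exact Finset.disjoint_left.1 hIO hxI hxO
    · exact (Finset.mem_compl.1 (hT hxT)) (Finset.mem_union_right _ hxO)
  · obtain ⟨-, hIS, -⟩ := Finset.mem_filter.1 hS
    exact Finset.union_sdiff_of_subset hIS
  · rw [Finset.mem_powerset] at hT
    rw [Finset.union_sdiff_left, Finset.sdiff_eq_self_iff_disjoint]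
    exact Finset.disjoint_left.2 fun x hxT hxI => (Finset.mem_compl.1 (hT hxT)) (Finset.mem_union_left _ hxI)
  · obtain ⟨-, hIS, -⟩ := Finset.mem_filter.1 hS
    rw [Finset.union_sdiff_of_subset hIS]

/-- **Splitting `2^{Q₀ ⊔ {∗}}` along `∗`** (`X_{n+1} = 0` / `X_{n+1} = 1`: the `g_k` / `h_k` halves).
[cite: BorceaBrandenLiggett2007, §6 proof of Thm. 6.4 (`G(X_{m+1},…,X_n, X_{n+1} = 0) = g_k`,
`G(…, X_{n+1} = 1) = h_k`)] -/
theorem sum_powerset_insert {σ : Type u} [DecidableEq σ] {s : Finset σ} {x : σ} (hx : x ∉ s)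
    (φ : Finset σ → ℝ) :
    ∑ B ∈ (insert x s).powerset, φ B = ∑ B ∈ s.powerset, (φ B + φ (insert x B)) := by
  have hdisj : Disjoint s.powerset (s.powerset.image (insert x)) :=
    Finset.disjoint_left.2 fun B hB hB' => by
      obtain ⟨B', -, rfl⟩ := Finset.mem_image.1 hB'
      exact hx (Finset.mem_powerset.1 hB (Finset.mem_insert_self x B'))
  have hinj : ∀ B ∈ s.powerset, ∀ B' ∈ s.powerset, insert x B = insert x B' → B = B' :=
      fun B hB B' hB' h => by
    rw [Finset.mem_powerset] at hB hB'
    rw [← Finset.erase_insert (fun h' => hx (hB h')), h, Finset.erase_insert (fun h' => hx (hB' h'))]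
  rw [Finset.powerset_insert, Finset.sum_union hdisj, Finset.sum_image hinj, ← Finset.sum_add_distrib]

/-- **Regrouping by cardinalities** (the sums "over all `S ⊆ [m]` such that `Σ X_i(S) = k`"):
`Σ_{A ⊆ P} Σ_{B ⊆ Q₀} Ξ(|A|+|B|+c) w^A w^B H_A(A) H_B(B) = Σ_{i,k} Ξ(i+k+c) (Σ_{|A|=i} w^A H_A)(Σ_{|B|=k} w^B H_B)`.
[cite: BorceaBrandenLiggett2007, §6 proof of Cor. 6.5 (`f_k = c_k^{-1} Σ F(S) Π w_i^{X_i(S)}`, `c_k`, `d_k`)] -/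
theorem sum_powerset_powerset_regroup {σ : Type u} [DecidableEq σ] (P Q₀ : Finset σ) (Ξ : ℕ → ℝ) (c : ℕ)
    (w : σ → ℝ) (HA HB : Finset σ → ℝ) :
    ∑ A ∈ P.powerset, ∑ B ∈ Q₀.powerset,
        Ξ (A.card + B.card + c) * ((∏ e ∈ A, w e) * ∏ e ∈ B, w e) * (HA A * HB B) =
      ∑ i ∈ range (P.card + 1), ∑ k ∈ range (Q₀.card + 1), Ξ (i + k + c) *
        ((∑ A ∈ P.powersetCard i, (∏ e ∈ A, w e) * HA A) * ∑ B ∈ Q₀.powersetCard k, (∏ e ∈ B, w e) * HB B) := by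
  rw [sum_powerset_eq_sum_powersetCard P]
  refine Finset.sum_congr rfl fun i _ => ?_
  have hAi : ∀ A ∈ P.powersetCard i, ∑ B ∈ Q₀.powerset,
      Ξ (A.card + B.card + c) * ((∏ e ∈ A, w e) * ∏ e ∈ B, w e) * (HA A * HB B) =
        ∑ k ∈ range (Q₀.card + 1), Ξ (i + k + c) *
          (((∏ e ∈ A, w e) * HA A) * ∑ B ∈ Q₀.powersetCard k, (∏ e ∈ B, w e) * HB B) := by
    intro A hA
    rw [(Finset.mem_powersetCard.1 hA).2, sum_powerset_eq_sum_powersetCard Q₀]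
    refine Finset.sum_congr rfl fun k _ => ?_
    rw [Finset.mul_sum, Finset.mul_sum]
    refine Finset.sum_congr rfl fun B hB => ?_
    rw [(Finset.mem_powersetCard.1 hB).2]
    ring
  rw [Finset.sum_congr rfl hAi, Finset.sum_comm]
  refine Finset.sum_congr rfl fun k _ => ?_
  rw [Finset.sum_mul (P.powersetCard i), Finset.mul_sum (P.powersetCard i)]

omit [Fintype τ] in
/-- Conditioning on `X_{n+1} = 0` leaves an exchangeable weight with profile `b`.
[cite: BorceaBrandenLiggett2007, §6 proof of Thm. 6.4 ("`a'_i = b'_i = b_{i+k}` if the conditioning is on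
`X_{n+1} = 0`")] -/
theorem pin_extField_almostExch_of_mem_O (a b : ℕ → ℝ) (w : Option τ → ℝ) {I O : Finset (Option τ)}
    (hO : none ∈ O) :
    pin I O (extField w (almostExch a b)) = pin I O (extField w fun S => b S.card) := by
  funext S
  rw [pin_apply, pin_apply]
  split_ifs with h
  · have hS : none ∉ S := fun hS => Finset.disjoint_left.1 h.2 hO hS
    rw [extField_apply, extField_apply, almostExch_apply, if_neg hS, Finset.card_eraseNone_of_not_mem hS]
  · rfl

omit [Fintype τ] in
/-- Conditioning on `X_{n+1} = 1` leaves an exchangeable weight with profile `(0, a_0, a_1, …)`.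
[cite: BorceaBrandenLiggett2007, §6 proof of Thm. 6.4 ("`a'_i = b'_i = a_{i+k}` if the conditioning is on
`X_{n+1} = 1`")] -/
theorem pin_extField_almostExch_of_mem_I (a b : ℕ → ℝ) (w : Option τ → ℝ) {I O : Finset (Option τ)}
    (hI : none ∈ I) :
    pin I O (extField w (almostExch a b)) =
      pin I O (extField w fun S => (fun k : ℕ => if k = 0 then (0 : ℝ) else a (k - 1)) S.card) := by
  funext S
  rw [pin_apply, pin_apply]
  split_ifs with h
  · have hS : none ∈ S := h.1 hI
    rw [extField_apply, extField_apply, almostExch_apply, if_pos hS, Finset.card_eraseNone_of_mem hS]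
    beta_reduce
    rw [if_neg (Finset.card_ne_zero_of_mem hS)]
  · rfl

/-- The shifted profile `(0, a_0, a_1, …)` is LC. [cite: BorceaBrandenLiggett2007, §2.1 Def. 2.8 (LC: no
internal zeros); §6 proof of Thm. 6.4] -/
theorem isLogConcaveSeq_succShift {a : ℕ → ℝ} (ha : IsLogConcaveSeq a) :
    IsLogConcaveSeq fun k => if k = 0 then (0 : ℝ) else a (k - 1) := by
  refine ⟨fun k => by dsimp only; split_ifs; exacts [le_rfl, ha.1 _], fun p q r s hpq hqs h => ?_⟩
  dsimp only
  by_cases hp : p = 0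
  · rw [if_pos hp, zero_mul]
    exact mul_nonneg (by split_ifs; exacts [le_rfl, ha.1 _]) (by split_ifs; exacts [le_rfl, ha.1 _])
  · rw [if_neg hp, if_neg (by omega), if_neg (by omega), if_neg (by omega)]
    exact ha.mul_le_mul (by omega) (by omega) (by omega)

/-- **The heart of Theorem 6.4 / Corollary 6.5**: for the almost exchangeable weight with LC profiles `a`, `b`
satisfying `{w_∗ a_k + b_k}` LC and (ii), conditioned on `I` in / `O` out with `∗` free and reweighted by an
external field `w ≥ 0` positive off `O`, the NA inequality holds for increasing `F`, `G` on disjoint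
coordinate sets with `∗` not among `F`'s coordinates. Proof as printed up to (cna2): the weighted symmetrizations
`f_i`, `g_k ≤ h_k` are increasing (Cor. 6.5 (a), the tree's `wAvg_mono`), `d_k` is LC (Cor. 6.5 (b)); then
(cna2) ≥ 0 pair by pair (`sum_mul_sum_le_of_ratio`) by the 0/1 reduction and the three-zone inequality
(`upset_ratio_le`). [cite: BorceaBrandenLiggett2007, §6 Thm. 6.4 (proof), Cor. 6.5 (proof)] -/
theorem negAssoc_almostExch_aux {a b : ℕ → ℝ} (ha : IsLogConcaveSeq a) (hb : IsLogConcaveSeq b)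
    {w : Option τ → ℝ} (hw0 : ∀ e, 0 ≤ w e) (hab : IsLogConcaveSeq fun k => w none * a k + b k)
    (hii : ∀ k, a (k + 1) * b k ≤ a k * b (k + 1)) {I O : Finset (Option τ)} (hIO : Disjoint I O)
    (hnI : none ∉ I) (hnO : none ∉ O) (hw : ∀ e, e ∉ O → 0 < w e)
    {F G : Finset (Option τ) → ℝ} (hF : Monotone F) (hG : Monotone G) {E₁ E₂ : Finset (Option τ)}
    (hFE : DeterminedBy F E₁) (hGE : DeterminedBy G E₂) (hdisj : Disjoint E₁ E₂) (hnE : none ∉ E₁) :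
    ex (pin I O (extField w (almostExch a b))) (F * G) * mass (pin I O (extField w (almostExch a b))) ≤
      ex (pin I O (extField w (almostExch a b))) F * ex (pin I O (extField w (almostExch a b))) G := by
  set μ : Finset (Option τ) → ℝ := almostExch a b with hμ
  set ν := pin I O (extField w μ) with hν
  -- the free coordinates, split along `E₁`; `∗` is on the `G` side
  set P : Finset (Option τ) := (I ∪ O)ᶜ ∩ E₁ with hP
  set Q : Finset (Option τ) := (I ∪ O)ᶜ \ E₁ with hQ
  have hPQ : Disjoint P Q := Finset.disjoint_left.2 fun x hxP hxQ =>
    (Finset.mem_sdiff.1 hxQ).2 (Finset.mem_inter.1 hxP).2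
  have hR : P ∪ Q = (I ∪ O)ᶜ := by
    ext x; simp only [hP, hQ, Finset.mem_union, Finset.mem_inter, Finset.mem_sdiff]; tauto
  have hnIO : none ∈ (I ∪ O)ᶜ := Finset.mem_compl.2 (by rw [Finset.mem_union, not_or]; exact ⟨hnI, hnO⟩)
  have hnQ : none ∈ Q := Finset.mem_sdiff.2 ⟨hnIO, hnE⟩
  have hnP : none ∉ P := fun h => hnE (Finset.mem_inter.1 h).2
  set Q₀ : Finset (Option τ) := Q.erase none with hQ₀
  have hnQ₀ : none ∉ Q₀ := Finset.notMem_erase none Q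
  have hQeq : Q = insert none Q₀ := (Finset.insert_erase hnQ).symm
  have hQ₀Q : Q₀ ⊆ Q := Finset.erase_subset _ _
  have hwP : ∀ e ∈ P, 0 < w e := fun e he =>
    hw e fun heO => (Finset.mem_compl.1 (Finset.mem_inter.1 he).1) (Finset.mem_union_right _ heO)
  have hwQ₀ : ∀ e ∈ Q₀, 0 < w e := fun e he =>
    hw e fun heO => (Finset.mem_compl.1 (Finset.mem_sdiff.1 (hQ₀Q he)).1) (Finset.mem_union_right _ heO)
  set m := P.card with hm
  set M := Q₀.card with hM
  set c := I.card with hc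
  set wI : ℝ := ∏ e ∈ I, w e with hwIdef
  have hwI : 0 ≤ wI := Finset.prod_nonneg fun e _ => hw0 e
  set lam : ℝ := w none with hlam
  have hlam0 : 0 ≤ lam := hw0 none
  -- the symmetrized test functions
  set Φ : Finset (Option τ) → ℝ := fun A => F (I ∪ A) with hΦ
  set Ψ₀ : Finset (Option τ) → ℝ := fun B => G (I ∪ B) with hΨ₀
  set Ψ₁ : Finset (Option τ) → ℝ := fun B => G (insert none (I ∪ B)) with hΨ₁
  have hΦmono : Monotone Φ := fun A B hAB => hF (Finset.union_subset_union (subset_refl I) hAB)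
  have hΨ₀mono : Monotone Ψ₀ := fun A B hAB => hG (Finset.union_subset_union (subset_refl I) hAB)
  have hΨ₁mono : Monotone Ψ₁ := fun A B hAB =>
    hG (Finset.insert_subset_insert none (Finset.union_subset_union (subset_refl I) hAB))
  have hΨ₀₁ : ∀ B, Ψ₀ B ≤ Ψ₁ B := fun B => hG (Finset.subset_insert _ _)
  -- values of `F`, `G`
  have hFval : ∀ A ∈ P.powerset, ∀ B ∈ Q.powerset, F (I ∪ (A ∪ B)) = Φ A := fun A hA B hB => by
    rw [Finset.mem_powerset] at hA hB
    refine hFE _ _ ?_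
    rw [← Finset.union_assoc, Finset.union_inter_distrib_right (I ∪ A) B E₁]
    have : B ∩ E₁ = ∅ := Finset.eq_empty_of_forall_notMem fun x hx =>
      (Finset.mem_sdiff.1 (hB (Finset.mem_inter.1 hx).1)).2 (Finset.mem_inter.1 hx).2
    rw [this, Finset.union_empty]
  have hGval : ∀ A ∈ P.powerset, ∀ B ∈ Q.powerset, G (I ∪ (A ∪ B)) = G (I ∪ B) := fun A hA B hB => by
    rw [Finset.mem_powerset] at hA hB
    refine hGE _ _ ?_
    have : A ∩ E₂ = ∅ := Finset.eq_empty_of_forall_notMem fun x hx =>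
      Finset.disjoint_left.1 hdisj (Finset.mem_inter.1 (hA (Finset.mem_inter.1 hx).1)).2 (Finset.mem_inter.1 hx).2
    rw [Finset.union_inter_distrib_right, Finset.union_inter_distrib_right, this, Finset.empty_union,
      ← Finset.union_inter_distrib_right]
  have pQ₀ : ∀ {B₀}, B₀ ∈ Q₀.powerset → B₀ ∈ Q.powerset := fun hB =>
    Finset.mem_powerset.2 ((Finset.mem_powerset.1 hB).trans hQ₀Q)
  have pQ₁ : ∀ {B₀}, B₀ ∈ Q₀.powerset → insert none B₀ ∈ Q.powerset := fun hB =>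
    Finset.mem_powerset.2 (Finset.insert_subset hnQ ((Finset.mem_powerset.1 hB).trans hQ₀Q))
  have hins : ∀ A B₀ : Finset (Option τ), I ∪ (A ∪ insert none B₀) = insert none (I ∪ (A ∪ B₀)) := fun A B₀ => by
    rw [Finset.union_insert, Finset.union_insert]
  have hGval₀ : ∀ A ∈ P.powerset, ∀ B₀ ∈ Q₀.powerset, G (I ∪ (A ∪ B₀)) = Ψ₀ B₀ := fun A hA B₀ hB₀ =>
    hGval A hA B₀ (pQ₀ hB₀)
  have hGval₁ : ∀ A ∈ P.powerset, ∀ B₀ ∈ Q₀.powerset, G (I ∪ (A ∪ insert none B₀)) = Ψ₁ B₀ :=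
    fun A hA B₀ hB₀ => by rw [hGval A hA _ (pQ₁ hB₀), Finset.union_insert]
  -- values of the weight and of the field
  have hnot : ∀ A ∈ P.powerset, ∀ B₀ ∈ Q₀.powerset, none ∉ I ∪ (A ∪ B₀) := fun A hA B₀ hB₀ h => by
    rw [Finset.mem_powerset] at hA hB₀
    rcases Finset.mem_union.1 h with h | h
    · exact hnI h
    · rcases Finset.mem_union.1 h with h | h
      · exact hnP (hA h)
      · exact hnQ₀ (hB₀ h)
  have hcard : ∀ A ∈ P.powerset, ∀ B₀ ∈ Q₀.powerset, (I ∪ (A ∪ B₀)).card = A.card + B₀.card + c := by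
    intro A hA B₀ hB₀
    rw [Finset.mem_powerset] at hA hB₀
    have hAB : A ∪ B₀ ⊆ (I ∪ O)ᶜ := by rw [← hR]; exact Finset.union_subset_union hA (hB₀.trans hQ₀Q)
    have hIAB : Disjoint I (A ∪ B₀) := Finset.disjoint_left.2 fun x hxI hx =>
      (Finset.mem_compl.1 (hAB hx)) (Finset.mem_union_left _ hxI)
    rw [Finset.card_union_of_disjoint hIAB, Finset.card_union_of_disjoint (hPQ.mono hA (hB₀.trans hQ₀Q))]
    omega
  have hμ0 : ∀ A ∈ P.powerset, ∀ B₀ ∈ Q₀.powerset, μ (I ∪ (A ∪ B₀)) = b (A.card + B₀.card + c) :=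
    fun A hA B₀ hB₀ => by
    rw [hμ, almostExch_apply, if_neg (hnot A hA B₀ hB₀), Finset.card_eraseNone_of_not_mem (hnot A hA B₀ hB₀),
      hcard A hA B₀ hB₀]
  have hμ1 : ∀ A ∈ P.powerset, ∀ B₀ ∈ Q₀.powerset, μ (I ∪ (A ∪ insert none B₀)) = a (A.card + B₀.card + c) :=
    fun A hA B₀ hB₀ => by
    rw [hins, hμ, almostExch_apply, if_pos (Finset.mem_insert_self _ _), eraseNone_insert_none,
      Finset.card_eraseNone_of_not_mem (hnot A hA B₀ hB₀), hcard A hA B₀ hB₀]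
  have hW0 : ∀ A ∈ P.powerset, ∀ B₀ ∈ Q₀.powerset,
      ∏ e ∈ I ∪ (A ∪ B₀), w e = wI * ((∏ e ∈ A, w e) * ∏ e ∈ B₀, w e) := fun A hA B₀ hB₀ => by
    rw [Finset.mem_powerset] at hA hB₀
    have hAB : A ∪ B₀ ⊆ (I ∪ O)ᶜ := by rw [← hR]; exact Finset.union_subset_union hA (hB₀.trans hQ₀Q)
    have hIAB : Disjoint I (A ∪ B₀) := Finset.disjoint_left.2 fun x hxI hx =>
      (Finset.mem_compl.1 (hAB hx)) (Finset.mem_union_left _ hxI)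
    rw [Finset.prod_union hIAB, Finset.prod_union (hPQ.mono hA (hB₀.trans hQ₀Q))]
  have hW1 : ∀ A ∈ P.powerset, ∀ B₀ ∈ Q₀.powerset,
      ∏ e ∈ I ∪ (A ∪ insert none B₀), w e = lam * (wI * ((∏ e ∈ A, w e) * ∏ e ∈ B₀, w e)) :=
    fun A hA B₀ hB₀ => by
    rw [hins, Finset.prod_insert (hnot A hA B₀ hB₀), hW0 A hA B₀ hB₀]
  -- expectations under `ν`: the two-term symmetrized formula
  have exW : ∀ H : Finset (Option τ) → ℝ,
      ex ν H = ex (pin I O μ) (fun S => (∏ e ∈ S, w e) * H S) := fun H => by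
    rw [ex_def, ex_def]
    refine Finset.sum_congr rfl fun S _ => ?_
    rw [hν, pin_extField, extField_apply]
    ring
  have eH : ∀ (H HA HB₀ HB₁ : Finset (Option τ) → ℝ),
      (∀ A ∈ P.powerset, ∀ B₀ ∈ Q₀.powerset, H (I ∪ (A ∪ B₀)) = HA A * HB₀ B₀) →
      (∀ A ∈ P.powerset, ∀ B₀ ∈ Q₀.powerset, H (I ∪ (A ∪ insert none B₀)) = HA A * HB₁ B₀) →
      ex ν H = wI * ((∑ i ∈ range (m + 1), ∑ k ∈ range (M + 1), b (i + k + c) *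
          ((∑ A ∈ P.powersetCard i, (∏ e ∈ A, w e) * HA A) * ∑ B ∈ Q₀.powersetCard k, (∏ e ∈ B, w e) * HB₀ B)) +
        lam * ∑ i ∈ range (m + 1), ∑ k ∈ range (M + 1), a (i + k + c) *
          ((∑ A ∈ P.powersetCard i, (∏ e ∈ A, w e) * HA A) * ∑ B ∈ Q₀.powersetCard k, (∏ e ∈ B, w e) * HB₁ B)) := by
    intro H HA HB₀ HB₁ h0 h1
    rw [← sum_powerset_powerset_regroup P Q₀ b c w HA HB₀, ← sum_powerset_powerset_regroup P Q₀ a c w HA HB₁,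
      exW, ex_pin_eq_sum_powerset hIO, ← hR, sum_powerset_union_of_disjoint hPQ,
      Finset.mul_sum P.powerset _ lam, ← Finset.sum_add_distrib, Finset.mul_sum P.powerset _ wI]
    refine Finset.sum_congr rfl fun A hA => ?_
    rw [hQeq, sum_powerset_insert hnQ₀, Finset.mul_sum Q₀.powerset _ lam, ← Finset.sum_add_distrib,
      Finset.mul_sum Q₀.powerset _ wI]
    refine Finset.sum_congr rfl fun B₀ hB₀ => ?_
    rw [h0 A hA B₀ hB₀, h1 A hA B₀ hB₀, hμ0 A hA B₀ hB₀, hμ1 A hA B₀ hB₀, hW0 A hA B₀ hB₀, hW1 A hA B₀ hB₀]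
    ring
  -- the four expectations
  have pcP : ∀ {i} {A}, A ∈ P.powersetCard i → A ∈ P.powerset := fun h =>
    Finset.mem_powerset.2 (Finset.mem_powersetCard.1 h).1
  have eFG := eH (F * G) Φ Ψ₀ Ψ₁
    (fun A hA B₀ hB₀ => by rw [Pi.mul_apply, hFval A hA B₀ (pQ₀ hB₀), hGval₀ A hA B₀ hB₀])
    (fun A hA B₀ hB₀ => by rw [Pi.mul_apply, hFval A hA _ (pQ₁ hB₀), hGval₁ A hA B₀ hB₀])
  have eF := eH F Φ (fun _ => 1) (fun _ => 1)
    (fun A hA B₀ hB₀ => by rw [hFval A hA B₀ (pQ₀ hB₀), mul_one])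
    (fun A hA B₀ hB₀ => by rw [hFval A hA _ (pQ₁ hB₀), mul_one])
  have eG := eH G (fun _ => 1) Ψ₀ Ψ₁
    (fun A hA B₀ hB₀ => by rw [hGval₀ A hA B₀ hB₀, one_mul])
    (fun A hA B₀ hB₀ => by rw [hGval₁ A hA B₀ hB₀, one_mul])
  have e1 := eH (fun _ => 1) (fun _ => 1) (fun _ => 1) (fun _ => 1)
    (fun A hA B₀ hB₀ => by rw [mul_one]) (fun A hA B₀ hB₀ => by rw [mul_one])
  have hmass : mass ν = ex ν (fun _ => 1) := by simp [mass_def, ex_def]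
  simp only [mul_one] at eF eG e1
  -- the symmetrized sums, profiles and averages
  set SΦ : ℕ → ℝ := fun i => ∑ A ∈ P.powersetCard i, (∏ e ∈ A, w e) * Φ A with hSΦ
  set cP : ℕ → ℝ := fun i => ∑ A ∈ P.powersetCard i, ∏ e ∈ A, w e with hcP
  set SΨ₀ : ℕ → ℝ := fun k => ∑ B ∈ Q₀.powersetCard k, (∏ e ∈ B, w e) * Ψ₀ B with hSΨ₀
  set SΨ₁ : ℕ → ℝ := fun k => ∑ B ∈ Q₀.powersetCard k, (∏ e ∈ B, w e) * Ψ₁ B with hSΨ₁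
  set dQ : ℕ → ℝ := fun k => ∑ B ∈ Q₀.powersetCard k, ∏ e ∈ B, w e with hdQ
  set a' : ℕ → ℝ := fun n => lam * a (n + c) with ha'
  set b' : ℕ → ℝ := fun n => b (n + c) with hb'
  set f : ℕ → ℝ := fun i => SΦ i / cP i with hf
  set g : ℕ → ℝ := fun k => SΨ₀ k / dQ k with hg
  set h : ℕ → ℝ := fun k => SΨ₁ k / dQ k with hh
  have hpos : ∀ (R : Finset (Option τ)), (∀ e ∈ R, 0 < w e) → ∀ i ∈ range (R.card + 1),
      (∑ A ∈ R.powersetCard i, ∏ e ∈ A, w e) ≠ 0 := fun R hwR i hi => by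
    rw [Finset.mem_range] at hi
    obtain ⟨A, hA⟩ : (R.powersetCard i).Nonempty := Finset.powersetCard_nonempty.2 (by omega)
    exact (lt_of_lt_of_le (Finset.prod_pos fun e he => hwR e ((Finset.mem_powersetCard.1 hA).1 he))
      (Finset.single_le_sum (f := fun A => ∏ e ∈ A, w e)
        (fun B _ => Finset.prod_nonneg fun e _ => hw0 e) hA)).ne'
  have hCi : ∀ i ∈ range (m + 1), cP i ≠ 0 := hpos P hwP
  have hCk : ∀ k ∈ range (M + 1), dQ k ≠ 0 := hpos Q₀ hwQ₀
  have hfc : ∀ i ∈ range (m + 1), f i * cP i = SΦ i := fun i hi => div_mul_cancel₀ _ (hCi i hi)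
  have hgd : ∀ k ∈ range (M + 1), g k * dQ k = SΨ₀ k := fun k hk => div_mul_cancel₀ _ (hCk k hk)
  have hhd : ∀ k ∈ range (M + 1), h k * dQ k = SΨ₁ k := fun k hk => div_mul_cancel₀ _ (hCk k hk)
  -- the folded forms of the four expectations
  have eFG' : ex ν (F * G) = wI * ((∑ i ∈ range (m + 1), ∑ k ∈ range (M + 1), b (i + k + c) * (SΦ i * SΨ₀ k)) +
      lam * ∑ i ∈ range (m + 1), ∑ k ∈ range (M + 1), a (i + k + c) * (SΦ i * SΨ₁ k)) := eFG
  have eF' : ex ν F = wI * ((∑ i ∈ range (m + 1), ∑ k ∈ range (M + 1), b (i + k + c) * (SΦ i * dQ k)) +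
      lam * ∑ i ∈ range (m + 1), ∑ k ∈ range (M + 1), a (i + k + c) * (SΦ i * dQ k)) := eF
  have eG' : ex ν G = wI * ((∑ i ∈ range (m + 1), ∑ k ∈ range (M + 1), b (i + k + c) * (cP i * SΨ₀ k)) +
      lam * ∑ i ∈ range (m + 1), ∑ k ∈ range (M + 1), a (i + k + c) * (cP i * SΨ₁ k)) := eG
  have e1' : mass ν = wI * ((∑ i ∈ range (m + 1), ∑ k ∈ range (M + 1), b (i + k + c) * (cP i * dQ k)) +
      lam * ∑ i ∈ range (m + 1), ∑ k ∈ range (M + 1), a (i + k + c) * (cP i * dQ k)) := by rw [hmass]; exact e1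
  -- the two kernels: `A_i` (test side) and `Z_i` (mass side)
  set SA : ℕ → ℝ := fun i => ∑ k ∈ range (M + 1), dQ k * (b' (i + k) * g k + a' (i + k) * h k) with hSA
  set SZ : ℕ → ℝ := fun i => ∑ k ∈ range (M + 1), dQ k * (b' (i + k) + a' (i + k)) with hSZ
  have rFG : ex ν (F * G) = wI * ∑ i ∈ range (m + 1), f i * (cP i * SA i) := by
    rw [eFG']
    congr 1
    simp only [hSA, Finset.mul_sum]
    rw [← Finset.sum_add_distrib]
    refine Finset.sum_congr rfl fun i hi => ?_
    rw [← Finset.sum_add_distrib]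
    refine Finset.sum_congr rfl fun k hk => ?_
    rw [← hfc i hi, ← hgd k hk, ← hhd k hk]
    simp only [ha', hb']
    ring
  have rF : ex ν F = wI * ∑ i ∈ range (m + 1), f i * (cP i * SZ i) := by
    rw [eF']
    congr 1
    simp only [hSZ, Finset.mul_sum]
    rw [← Finset.sum_add_distrib]
    refine Finset.sum_congr rfl fun i hi => ?_
    rw [← Finset.sum_add_distrib]
    refine Finset.sum_congr rfl fun k hk => ?_
    rw [← hfc i hi]
    simp only [ha', hb']
    ring
  have rG : ex ν G = wI * ∑ i ∈ range (m + 1), cP i * SA i := by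
    rw [eG']
    congr 1
    simp only [hSA, Finset.mul_sum]
    rw [← Finset.sum_add_distrib]
    refine Finset.sum_congr rfl fun i hi => ?_
    rw [← Finset.sum_add_distrib]
    refine Finset.sum_congr rfl fun k hk => ?_
    rw [← hgd k hk, ← hhd k hk]
    simp only [ha', hb']
    ring
  have r1 : mass ν = wI * ∑ i ∈ range (m + 1), cP i * SZ i := by
    rw [e1']
    congr 1
    simp only [hSZ, Finset.mul_sum]
    rw [← Finset.sum_add_distrib]
    refine Finset.sum_congr rfl fun i hi => ?_
    rw [← Finset.sum_add_distrib]
    refine Finset.sum_congr rfl fun k hk => ?_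
    simp only [ha', hb']
    ring
  -- hypotheses of the pairwise inequality
  have ha'LC : IsLogConcaveSeq a' := (isLogConcaveSeq_shift ha c).const_mul hlam0
  have hb'LC : IsLogConcaveSeq b' := isLogConcaveSeq_shift hb c
  have hab' : IsLogConcaveSeq fun n => a' n + b' n := isLogConcaveSeq_shift hab c
  have hii' : ∀ k, a' (k + 1) * b' k ≤ a' k * b' (k + 1) := fun k => by
    simp only [ha', hb']
    rw [Nat.add_right_comm k 1 c]
    have := mul_le_mul_of_nonneg_left (hii (k + c)) hlam0
    nlinarith [this]
  have hdQ : IsLogConcaveSeq dQ := isLogConcaveSeq_esymmVal Q₀ fun e _ => hw0 e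
  have hgm : ∀ k k', k ≤ k' → k' ≤ M → g k ≤ g k' := wAvg_mono Q₀ hw0 hwQ₀ hΨ₀mono
  have hhm : ∀ k k', k ≤ k' → k' ≤ M → h k ≤ h k' := wAvg_mono Q₀ hw0 hwQ₀ hΨ₁mono
  have hgh : ∀ k, k ≤ M → g k ≤ h k := fun k hk => by
    simp only [hg, hh]
    refine div_le_div_of_nonneg_right (Finset.sum_le_sum fun B _ =>
      mul_le_mul_of_nonneg_left (hΨ₀₁ B) (Finset.prod_nonneg fun e _ => hw0 e))
      (Finset.sum_nonneg fun B _ => Finset.prod_nonneg fun e _ => hw0 e)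
  have hfm : ∀ i i', i ≤ i' → i' ≤ m → f i ≤ f i' := wAvg_mono P hw0 hwP hΦmono
  have hcP0 : ∀ i, 0 ≤ cP i := fun i => Finset.sum_nonneg fun A _ => Finset.prod_nonneg fun e _ => hw0 e
  have hAZ : ∀ i j, i < j → j ≤ m → (cP j * SA j) * (cP i * SZ i) ≤ (cP i * SA i) * (cP j * SZ j) := by
    intro i j hij _
    have key := upset_ratio_le ha'LC hb'LC hab' hii' hdQ M hgm hhm hgh hij
    calc (cP j * SA j) * (cP i * SZ i) = (cP i * cP j) * (SA j * SZ i) := by ring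
      _ ≤ (cP i * cP j) * (SA i * SZ j) := mul_le_mul_of_nonneg_left key (mul_nonneg (hcP0 i) (hcP0 j))
      _ = (cP i * SA i) * (cP j * SZ j) := by ring
  have key := sum_mul_sum_le_of_ratio m f (fun i => cP i * SA i) (fun i => cP i * SZ i) hAZ hfm
  rw [rFG, r1, rF, rG]
  calc wI * (∑ i ∈ range (m + 1), f i * (cP i * SA i)) * (wI * ∑ i ∈ range (m + 1), cP i * SZ i)
      = (wI * wI) * ((∑ i ∈ range (m + 1), f i * (cP i * SA i)) * ∑ i ∈ range (m + 1), cP i * SZ i) := by ring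
    _ ≤ (wI * wI) * ((∑ i ∈ range (m + 1), f i * (cP i * SZ i)) * ∑ i ∈ range (m + 1), cP i * SA i) :=
        mul_le_mul_of_nonneg_left key (mul_nonneg hwI hwI)
    _ = wI * (∑ i ∈ range (m + 1), f i * (cP i * SZ i)) * (wI * ∑ i ∈ range (m + 1), cP i * SA i) := by ring

/-- **NA of the conditioned, reweighted almost exchangeable weight** — all cases: `∗` conditioned out
(profile `b`), conditioned in (profile `a`), or free (the symmetrization argument, with `F` and `G` swapped if
`∗` is among `F`'s coordinates). [cite: BorceaBrandenLiggett2007, §6 Thm. 6.4 (proof: "it is enough to prove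
that `μ` is NA … the resulting measure is of the same form"), Cor. 6.5 (proof)] -/
theorem isNegAssoc_pin_extField_almostExch {a b : ℕ → ℝ} (ha : IsLogConcaveSeq a) (hb : IsLogConcaveSeq b)
    {w : Option τ → ℝ} (hw0 : ∀ e, 0 ≤ w e) (hab : IsLogConcaveSeq fun k => w none * a k + b k)
    (hii : ∀ k, a (k + 1) * b k ≤ a k * b (k + 1)) (I O : Finset (Option τ)) (hw : ∀ e, e ∉ O → 0 < w e) :
    IsNegAssoc (pin I O (extField w (almostExch a b : Finset (Option τ) → ℝ))) := by
  intro F G hF hG E₁ E₂ hFE hGE hdisj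
  by_cases hIO : Disjoint I O
  swap
  · have hz : ∀ S, pin I O (extField w (almostExch a b : Finset (Option τ) → ℝ)) S = 0 := fun S => by
      rw [pin_apply, if_neg]
      rintro ⟨hIS, hOS⟩
      exact hIO (hOS.symm.mono_left hIS)
    have hex : ∀ H : Finset (Option τ) → ℝ, ex (pin I O (extField w (almostExch a b))) H = 0 := fun H =>
      Finset.sum_eq_zero fun S _ => by rw [hz S, zero_mul]
    rw [hex, hex, hex, zero_mul, zero_mul]
  by_cases hnO : none ∈ O
  · rw [pin_extField_almostExch_of_mem_O a b w hnO]
    exact isNegAssoc_pin_extField_card hb hw0 I O hw hF hG hFE hGE hdisj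
  by_cases hnI : none ∈ I
  · rw [pin_extField_almostExch_of_mem_I a b w hnI]
    exact isNegAssoc_pin_extField_card (isLogConcaveSeq_succShift ha) hw0 I O hw hF hG hFE hGE hdisj
  by_cases hnE : none ∈ E₁
  · have hnE₂ : none ∉ E₂ := fun h => Finset.disjoint_left.1 hdisj hnE h
    have key := negAssoc_almostExch_aux ha hb hw0 hab hii hIO hnI hnO hw hG hF hGE hFE hdisj.symm hnE₂
    rwa [mul_comm G F, mul_comm (ex _ G)] at key
  · exact negAssoc_almostExch_aux ha hb hw0 hab hii hIO hnI hnO hw hF hG hFE hGE hdisj hnE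

end Symmetrization

/-! ## §4 Theorem 6.4, Corollary 6.5, Corollary 6.6 -/

section Main

variable {τ : Type u} [Fintype τ] [DecidableEq τ]

omit [Fintype τ] [DecidableEq τ] in
/-- The trivial field. [cite: BorceaBrandenLiggett2007, §2.1 (external fields)] -/
theorem extField_one_eq {σ : Type u} [DecidableEq σ] (μ : Finset σ → ℝ) : extField (fun _ => (1 : ℝ)) μ = μ :=
  funext fun S => by rw [extField_apply, Finset.prod_const_one, mul_one]

/-- **Borcea–Brändén–Liggett, Theorem 6.4.** Let `g = z_{n+1} Σ_k a_k e_k(z_1,…,z_n) + Σ_k b_k e_k(z_1,…,z_n)`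
with `{a_k}`, `{b_k}` LC sequences such that (i) `{a_k + b_k}` is LC and (ii) `a_k b_{k+1} ≥ a_{k+1} b_k`. Then
`μ` is CNA. [cite: BorceaBrandenLiggett2007, §6 Thm. 6.4] -/
theorem isCNA_almostExch {a b : ℕ → ℝ} (ha : IsLogConcaveSeq a) (hb : IsLogConcaveSeq b)
    (hab : IsLogConcaveSeq fun k => a k + b k) (hii : ∀ k, a (k + 1) * b k ≤ a k * b (k + 1)) :
    IsCNA (almostExch a b : Finset (Option τ) → ℝ) := by
  intro I O
  have hab1 : IsLogConcaveSeq fun k => (fun _ : Option τ => (1 : ℝ)) none * a k + b k := by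
    simpa only [one_mul] using hab
  have key := isNegAssoc_pin_extField_almostExch ha hb (w := fun _ => (1 : ℝ)) (fun _ => zero_le_one) hab1 hii
    I O (fun _ _ => one_pos)
  rwa [extField_one_eq] at key

/-- Theorem 6.4, unconditioned: the almost exchangeable measure is NA. [cite: BorceaBrandenLiggett2007, §6
Thm. 6.4] -/
theorem isNegAssoc_almostExch {a b : ℕ → ℝ} (ha : IsLogConcaveSeq a) (hb : IsLogConcaveSeq b)
    (hab : IsLogConcaveSeq fun k => a k + b k) (hii : ∀ k, a (k + 1) * b k ≤ a k * b (k + 1)) :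
    IsNegAssoc (almostExch a b : Finset (Option τ) → ℝ) :=
  (isCNA_almostExch ha hb hab hii).isNegAssoc

/-- **Borcea–Brändén–Liggett, Corollary 6.5.** If `{a_k}`, `{b_k}` are LC sequences with (i) `{λ a_k + b_k}` LC
for all `λ > 0` and (ii) `a_k b_{k+1} ≥ a_{k+1} b_k`, then `μ` is CNA+ (external fields by the weighted
symmetrization; projections because CNA passes to projections, `IsCNA.projectOn`).
[cite: BorceaBrandenLiggett2007, §6 Cor. 6.5] -/
theorem isCNAPlus_almostExch {a b : ℕ → ℝ} (ha : IsLogConcaveSeq a) (hb : IsLogConcaveSeq b)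
    (hi : ∀ l : ℝ, 0 < l → IsLogConcaveSeq fun k => l * a k + b k)
    (hii : ∀ k, a (k + 1) * b k ≤ a k * b (k + 1)) :
    IsCNAPlus (almostExch a b : Finset (Option τ) → ℝ) := by
  intro w hw0 S
  refine IsCNA.projectOn (fun I O => ?_) S
  have habw : IsLogConcaveSeq fun k => w none * a k + b k := by
    rcases (hw0 none).eq_or_lt with h0 | hpos
    · rw [← h0]; simpa only [zero_mul, zero_add] using hb
    · exact hi _ hpos
  rw [extField_eq_pin_zeroSet, pin_pin, Finset.union_empty]
  refine isNegAssoc_pin_extField_almostExch ha hb hw0 habw hii _ _ fun e he => ?_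
  rw [Finset.mem_union, not_or, Finset.mem_filter] at he
  exact lt_of_le_of_ne (hw0 e) fun h => he.2 ⟨Finset.mem_univ e, h.symm⟩

/-- **Borcea–Brändén–Liggett, Corollary 6.6, first bullet**: for an almost symmetric measure,
Rayleigh/h-NLC+ ⟺ CNA+ (Prop. 6.2 and Cor. 6.5 one way, Remark 2.4 the other). Profiles nonnegative and
vanishing above `n = |τ|` (no restriction on the measure). [cite: BorceaBrandenLiggett2007, §6 Cor. 6.6;
Prop. 6.2; §2.1 Remark 2.4] -/
theorem BorceaBrandenLiggett_cor_6_6_rayleigh {a b : ℕ → ℝ} (ha : ∀ k, 0 ≤ a k) (hb : ∀ k, 0 ≤ b k)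
    (ha0 : ∀ k, Fintype.card τ < k → a k = 0) (hb0 : ∀ k, Fintype.card τ < k → b k = 0) :
    (IsRayleigh (almostExch a b : Finset (Option τ) → ℝ) ↔ IsCNAPlus (almostExch a b : Finset (Option τ) → ℝ)) ∧
      (IsHNLCPlus (almostExch a b : Finset (Option τ) → ℝ) ↔ IsCNAPlus (almostExch a b : Finset (Option τ) → ℝ)) := by
  have h0 : ∀ S, 0 ≤ (almostExch a b : Finset (Option τ) → ℝ) S := almostExch_nonneg ha hb
  have main : IsRayleigh (almostExch a b : Finset (Option τ) → ℝ) → IsCNAPlus (almostExch a b : Finset (Option τ) → ℝ) := by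
    intro h
    obtain ⟨hi, hii⟩ := BorceaBrandenLiggett_prop_6_2_onlyIf ha hb ha0 hb0 h
    obtain ⟨haLC, hbLC, -⟩ := condition_i_6_3_of_6_2 hi
    refine isCNAPlus_almostExch haLC hbLC (fun l hl => ?_) hii
    have h1 : 0 < 1 + l := by linarith
    have key := (hi (l / (1 + l)) (div_nonneg hl.le h1.le) ((div_le_one h1).2 (by linarith))).const_mul h1.le
    have heq : (fun k => (1 + l) * (l / (1 + l) * a k + (1 - l / (1 + l)) * b k)) = fun k => l * a k + b k :=
      funext fun k => by field_simp; ring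
    rwa [heq] at key
  refine ⟨⟨main, fun h => h.isRayleigh⟩, ⟨fun h => main (isRayleigh_of_isHNLCPlus h), fun h => h.isHNLCPlus h0⟩⟩

/-- **Borcea–Brändén–Liggett, Corollary 6.6, second bullet**: for an almost symmetric measure, h-NLC ⟺ CNA
(Prop. 6.3 and Thm. 6.4 one way, Remark 2.4 — the tree's `IsCNA.isHNLC` — the other); "Pemantle's Conjecture
2.5 is true for almost symmetric measures". [cite: BorceaBrandenLiggett2007, §6 Cor. 6.6; Prop. 6.3, Thm. 6.4;
§2.1 Remark 2.4] -/
theorem BorceaBrandenLiggett_cor_6_6_hnlc {a b : ℕ → ℝ} (ha : ∀ k, 0 ≤ a k) (hb : ∀ k, 0 ≤ b k)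
    (ha0 : ∀ k, Fintype.card τ < k → a k = 0) (hb0 : ∀ k, Fintype.card τ < k → b k = 0) :
    IsHNLC (almostExch a b : Finset (Option τ) → ℝ) ↔ IsCNA (almostExch a b : Finset (Option τ) → ℝ) := by
  refine ⟨fun h => ?_, fun h => h.isHNLC (almostExch_nonneg ha hb)⟩
  obtain ⟨⟨haLC, hbLC, hab⟩, hii⟩ := BorceaBrandenLiggett_prop_6_3_onlyIf ha hb ha0 hb0 h
  exact isCNA_almostExch haLC hbLC hab hii

/-- **Corollary 6.6 as printed** (both bullets). [cite: BorceaBrandenLiggett2007, §6 Cor. 6.6] -/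
theorem BorceaBrandenLiggett_cor_6_6 {a b : ℕ → ℝ} (ha : ∀ k, 0 ≤ a k) (hb : ∀ k, 0 ≤ b k)
    (ha0 : ∀ k, Fintype.card τ < k → a k = 0) (hb0 : ∀ k, Fintype.card τ < k → b k = 0) :
    (IsRayleigh (almostExch a b : Finset (Option τ) → ℝ) ↔ IsCNAPlus (almostExch a b : Finset (Option τ) → ℝ)) ∧
      (IsHNLC (almostExch a b : Finset (Option τ) → ℝ) ↔ IsCNA (almostExch a b : Finset (Option τ) → ℝ)) :=
  ⟨(BorceaBrandenLiggett_cor_6_6_rayleigh ha hb ha0 hb0).1, BorceaBrandenLiggett_cor_6_6_hnlc ha hb ha0 hb0⟩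

end Main

end Literature.Probability.NegativeDependence

end
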